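import Summits.BirchSwinnertonDyer.BirchSwinnertonDyer.Theorems.ManinLocalTwoThreeRootSqueezeEleven
import Summits.BirchSwinnertonDyer.BirchSwinnertonDyer.Theorems.ManinLocalTwoThreeOddTwistRootFormTransport
import Literature.NumberTheory.EllipticCurves.KubertTateFiveEisensteinTwistMinimalModel
import Literature.NumberTheory.EllipticCurves.LocalReductionKrausMinimality
import HarnessLib

/-!
# The ODD twist families of the root `11a` from (S2)₁₁: `|c| = 1` on every `χ_p`-twist image of `ι₁φ₁₁` at the levels `44 ∣ N`, `p² ∣ N`
# (`p` an odd prime `≠ 11`) — in particular the C2 ∧ C3 shape at `396 = 4·9·11` and the residual C5 shape at `1100 = 4·25·11`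

Cell `bsd-f2-manin`, route `ManinLocalTwoThree` (cruxes C2 `ManinOddAtFour` stmt-BirchSwinnertonDyer-22967 / C3 `ManinPrimeToThreeAtNine` stmt-22968),
prover seat p3 gen 27; `--supports` (helper).  p3 g26's ENGINE `…OddTwistRootFormTransport` (THEOREM 68.A without a root datum) fed with this
seat's ROOT SQUEEZE `RootSqueezeEleven.periodLatticeLe_iota_phi11` (`Λ(ι₁φ₁₁) ⊆ Λ_Néron(11a1)`, weight-4 Bracket–Sturm on `X₀(44)`) and the
root curve `11a1 = [0, −1, 1, −10, −20]` (globally minimal, `Δ = −11⁵`; GOOD at every prime `p ≠ 11` — `p ∤ Δ` on the integer model):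
* `abs_maninConstant_eq_one_of_charTwist_iota_phi11`: for `p` an odd prime `≠ 11`, `χ` the primitive quadratic character mod `p`, `44 ∣ N`, `p² ∣ N`,
  every lattice-optimal `X₀(N)`-datum `D` of a globally minimal `W` with `D.f = (ι₁φ₁₁)^χ` has `|c(D)| = 1` (and no prime divides `c`);
  the coefficient form `…_of_cuspCoeff` (`aₙ(D.f) = χ(n)·aₙ(φ₁₁)` for all `n`);
* named members: `396 = 2²·3²·11` (`p = 3`: `|c| = 1 ∧ 2 ∤ c ∧ 3 ∤ c` — BOTH crux shapes), `1100 = 2²·5²·11` (`p = 5`: `|c| = 1 ∧ 2 ∤ c ∧ 5 ∤ c` —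
  C2 and the residual C5 shape).
HONEST SCOPE: hypothesis-shaped (the statements cover exactly the data whose newform IS the twist — no pinning at `396`/`1100` is claimed);
unconditional (standard axioms); nothing here proves C2, C3 (∀ N), Manin's conjecture or BSD.  No definition, no named fact, no sorry.
[cite: Stevens1989, Lemma (5.2) p. 96, Lemma (5.4) p. 97] [cite: AgasheRibetStein2006, §§1–2] [cite: CremonaAlgorithms1997, Table 1 (11a1)]
[cite: SilvermanAEC2009, VII.1 Remark 1.1, VII.5 Prop. 5.1]
-/

set_option autoImplicit false
-- lint-debt: the directory name repeats the summit name (sibling precedent `ManinLocalTwoThreeOddTwistRootFormTransport.lean`)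
set_option linter.dupNamespace false

noncomputable section

open scoped MatrixGroups ModularForm
open ModularForm CongruenceSubgroup WeierstrassCurve
open Literature.NumberTheory.EllipticCurves Literature.NumberTheory.EllipticCurves.ModularForms

namespace Summit.BirchSwinnertonDyer.BirchSwinnertonDyer.Theorems.ManinLocalTwoThree.RootSqueezeEleven

open Literature.NumberTheory.EllipticCurves.Rank1Residual.X11RankOneCertificates (discOf c4Of c6Of)

/-! ## §1 The root curve `11a1` -/

/-- `Δ, c₄, c₆` of `11a1`: `−161051 = −11⁵, 496, 20008`. [cite: CremonaAlgorithms1997, Table 1 (11a1)] -/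
theorem invariants_elevenA1 : discOf [0, -1, 1, -10, -20] = -161051 ∧ c4Of [0, -1, 1, -10, -20] = 496 ∧ c6Of [0, -1, 1, -10, -20] = 20008 := by
  refine ⟨?_, ?_, ?_⟩ <;> decide

/-- `11a1` (integer-cast model) is globally minimal (`|Δ| = 11⁵`: no `q¹² ∣ Δ`). [cite: SilvermanAEC2009, VII.1 Remark 1.1] -/
theorem isGloballyMinimal_elevenA1_cast :
    (⟨((0 : ℤ) : ℚ), ((-1 : ℤ) : ℚ), ((1 : ℤ) : ℚ), ((-10 : ℤ) : ℚ), ((-20 : ℤ) : ℚ)⟩ : WeierstrassCurve ℚ).IsGloballyMinimal := by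
  obtain ⟨hD, -, -⟩ := invariants_elevenA1
  refine WeierstrassCurve.isGloballyMinimal_of_int_kraus 0 (-1) 1 (-10) (-20) fun q hq ↦ Or.inl fun h ↦ ?_
  obtain ⟨h12, -⟩ := h
  rw [hD] at h12
  have hq1 : (q : ℤ) ∣ 161051 := dvd_neg.mp (dvd_trans (dvd_pow_self _ (by norm_num)) h12)
  have hdvdN : q ∣ 11 ^ 5 := by
    have e : ((11 ^ 5 : ℕ) : ℤ) = 161051 := by norm_num
    exact Int.natCast_dvd_natCast.mp (e ▸ hq1)
  have hpi := Nat.Prime.prime hq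
  have := (Nat.prime_dvd_prime_iff_eq hq (by norm_num : Nat.Prime 11)).mp (hpi.dvd_of_dvd_pow hdvdN)
  subst this; revert h12; norm_num

/-- `11a1` is globally minimal. [cite: SilvermanAEC2009, VII.1 Remark 1.1] -/
theorem isGloballyMinimal_elevenA1 : (⟨0, -1, 1, -10, -20⟩ : WeierstrassCurve ℚ).IsGloballyMinimal := by
  rw [show (⟨0, -1, 1, -10, -20⟩ : WeierstrassCurve ℚ) =
      ⟨((0 : ℤ) : ℚ), ((-1 : ℤ) : ℚ), ((1 : ℤ) : ℚ), ((-10 : ℤ) : ℚ), ((-20 : ℤ) : ℚ)⟩ by ext <;> norm_num]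
  exact isGloballyMinimal_elevenA1_cast

/-- **`11a1` has GOOD reduction at every prime `p ≠ 11`** (`p ∤ Δ = −11⁵` on the integer model). [cite: SilvermanAEC2009, VII.5 Prop. 5.1] -/
theorem hasGoodReductionAtPrime_elevenA1 {p : ℕ} [Fact p.Prime] (hp11 : p ≠ 11) :
    (⟨0, -1, 1, -10, -20⟩ : WeierstrassCurve ℚ).HasGoodReductionAtPrime p := by
  haveI := isElliptic_elevenA1
  refine WeierstrassCurve.hasGoodReductionAtPrime_of_map_int_of_not_dvd _ (⟨0, -1, 1, -10, -20⟩ : WeierstrassCurve ℤ)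
    (by ext <;> simp) p fun h ↦ ?_
  have hΔ : (⟨0, -1, 1, -10, -20⟩ : WeierstrassCurve ℤ).Δ = -(11 ^ 5) := by
    norm_num [WeierstrassCurve.Δ, WeierstrassCurve.b₂, WeierstrassCurve.b₄, WeierstrassCurve.b₆, WeierstrassCurve.b₈]
  rw [hΔ, dvd_neg] at h
  have hp : p.Prime := Fact.out
  have h' : (p : ℤ) ∣ 11 := Int.Prime.dvd_pow' hp h
  have h'' : p ∣ 11 := by exact_mod_cast h'
  exact hp11 ((Nat.prime_dvd_prime_iff_eq hp (by norm_num)).mp h'')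

/-! ## §2 The odd twist family of `ι₁φ₁₁` -/

/-- **`|c| = 1` ON EVERY ODD TWIST IMAGE OF `ι₁φ₁₁`** (`p` odd, `p ≠ 11`; `44 ∣ N`, `p² ∣ N`; `D.f = (ι₁φ₁₁)^χ` as a `charTwist`).
[cite: Stevens1989, Lemma (5.2) p. 96, Lemma (5.4) p. 97] [cite: AgasheRibetStein2006, §§1–2] -/
theorem abs_maninConstant_eq_one_of_charTwist_iota_phi11 {p : ℕ} [Fact p.Prime] (hp2 : p ≠ 2) (hp11 : p ≠ 11)
    {χ : DirichletCharacter ℂ p} (hχ : χ.IsQuadratic) (hprim : χ.IsPrimitive)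
    (W : WeierstrassCurve ℚ) [W.IsElliptic] [W.IsGloballyMinimal] {N : ℕ} [NeZero N]
    (D : ModularParametrizationData W N) (h44 : 44 ∣ N) (hpN : p ^ 2 ∣ N)
    (hf : D.f = charTwist N h44 hpN hχ (degeneracyMap0 11 44 1 2 cuspFormEtaProductEleven))
    (hopt : ∀ z ∈ D.L.lattice, ∃ w ∈ periodLattice D.f, z = D.c * w) :
    |D.maninConstant| = 1 := by
  haveI := isElliptic_elevenA1
  haveI := isGloballyMinimal_elevenA1
  obtain ⟨L₀, h2, h3⟩ := ((⟨0, -1, 1, -10, -20⟩ : WeierstrassCurve ℚ).baseChange ℂ).exists_periodPair_of_isElliptic'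
  have hL₀ : IsNeronLatticeOf ((⟨0, -1, 1, -10, -20⟩ : WeierstrassCurve ℚ).baseChange ℂ) L₀ := ⟨h2, h3⟩
  exact OddTwistRootForm.abs_maninConstant_eq_one_of_rootForm_charTwist_eq hp2 hχ hprim _ (⟨0, -1, 1, -10, -20⟩ : WeierstrassCurve ℚ)
    L₀ hL₀ (periodLatticeLe_iota_phi11 hL₀) (Or.inl (hasGoodReductionAtPrime_elevenA1 hp11)) W D h44 hpN hf hopt

/-- **The same from the coefficient relation** `aₙ(D.f) = χ(n)·aₙ(φ₁₁)` (all `n`), e.g. as produced by a pinning row. [cite: Stevens1989, Lemma (5.4) p. 97] -/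
theorem abs_maninConstant_eq_one_of_cuspCoeff_chi_phi11 {p : ℕ} [Fact p.Prime] (hp2 : p ≠ 2) (hp11 : p ≠ 11)
    {χ : DirichletCharacter ℂ p} (hχ : χ.IsQuadratic) (hprim : χ.IsPrimitive)
    (W : WeierstrassCurve ℚ) [W.IsElliptic] [W.IsGloballyMinimal] {N : ℕ} [NeZero N]
    (D : ModularParametrizationData W N) (h44 : 44 ∣ N) (hpN : p ^ 2 ∣ N)
    (hf : ∀ n : ℕ, cuspCoeff D.f n = χ n * cuspCoeff cuspFormEtaProductEleven n)
    (hopt : ∀ z ∈ D.L.lattice, ∃ w ∈ periodLattice D.f, z = D.c * w) :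
    |D.maninConstant| = 1 := by
  haveI := isElliptic_elevenA1
  haveI := isGloballyMinimal_elevenA1
  obtain ⟨L₀, h2, h3⟩ := ((⟨0, -1, 1, -10, -20⟩ : WeierstrassCurve ℚ).baseChange ℂ).exists_periodPair_of_isElliptic'
  have hL₀ : IsNeronLatticeOf ((⟨0, -1, 1, -10, -20⟩ : WeierstrassCurve ℚ).baseChange ℂ) L₀ := ⟨h2, h3⟩
  exact OddTwistRootForm.abs_maninConstant_eq_one_of_rootForm_oddTwist hp2 hχ hprim _ (⟨0, -1, 1, -10, -20⟩ : WeierstrassCurve ℚ)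
    L₀ hL₀ (periodLatticeLe_iota_phi11 hL₀) (Or.inl (hasGoodReductionAtPrime_elevenA1 hp11)) W D h44 hpN
    (fun n ↦ by rw [hf n, cuspCoeff_degeneracyMap0_one (⟨4, rfl⟩ : 11 ∣ 44)]) hopt

/-- No integer `q` with `|q| ≠ 1` divides `c` on the family. [cite: AgasheRibetStein2006, §§1–2] -/
theorem not_dvd_maninConstant_of_cuspCoeff_chi_phi11 {p : ℕ} [Fact p.Prime] (hp2 : p ≠ 2) (hp11 : p ≠ 11)
    {χ : DirichletCharacter ℂ p} (hχ : χ.IsQuadratic) (hprim : χ.IsPrimitive)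
    (W : WeierstrassCurve ℚ) [W.IsElliptic] [W.IsGloballyMinimal] {N : ℕ} [NeZero N]
    (D : ModularParametrizationData W N) (h44 : 44 ∣ N) (hpN : p ^ 2 ∣ N)
    (hf : ∀ n : ℕ, cuspCoeff D.f n = χ n * cuspCoeff cuspFormEtaProductEleven n)
    (hopt : ∀ z ∈ D.L.lattice, ∃ w ∈ periodLattice D.f, z = D.c * w) {q : ℤ} (hq : q.natAbs ≠ 1) :
    ¬ q ∣ D.maninConstant := by
  intro h
  have h1 := abs_maninConstant_eq_one_of_cuspCoeff_chi_phi11 hp2 hp11 hχ hprim W D h44 hpN hf hopt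
  have hn : D.maninConstant.natAbs = 1 := by
    rw [Int.abs_eq_natAbs] at h1
    exact_mod_cast h1
  have h2 : q.natAbs ∣ 1 := hn ▸ Int.natAbs_dvd_natAbs.mpr h
  exact hq (Nat.dvd_one.mp h2)

/-! ## §3 Named members: `396` (C2 ∧ C3) and `1100` (C2, residual C5) -/

/-- **C2 ∧ C3 shape at `396 = 2²·3²·11` on the `χ₋₃`-image of `11a`**: every lattice-optimal `X₀(396)`-datum whose newform is the twist of `φ₁₁`
by the primitive quadratic character mod `3` has `|c| = 1`, `2 ∤ c`, `3 ∤ c`.  No printed fact. [cite: CremonaAlgorithms1997, Table 1 (396)] -/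
theorem shapes_threeNinetySix [Fact (Nat.Prime 3)] (χ : DirichletCharacter ℂ 3) (hχ : χ.IsQuadratic) (hprim : χ.IsPrimitive)
    (W : WeierstrassCurve ℚ) [W.IsElliptic] [W.IsGloballyMinimal] [NeZero (396 : ℕ)] (D : ModularParametrizationData W 396)
    (hf : ∀ n : ℕ, cuspCoeff D.f n = χ n * cuspCoeff cuspFormEtaProductEleven n)
    (hopt : ∀ z ∈ D.L.lattice, ∃ w ∈ periodLattice D.f, z = D.c * w) :
    |D.maninConstant| = 1 ∧ ¬ (2 : ℤ) ∣ D.maninConstant ∧ ¬ (3 : ℤ) ∣ D.maninConstant :=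
  ⟨abs_maninConstant_eq_one_of_cuspCoeff_chi_phi11 (p := 3) (by norm_num) (by norm_num) hχ hprim W D (by norm_num) (by norm_num) hf hopt,
   not_dvd_maninConstant_of_cuspCoeff_chi_phi11 (p := 3) (by norm_num) (by norm_num) hχ hprim W D (by norm_num) (by norm_num) hf hopt (by decide),
   not_dvd_maninConstant_of_cuspCoeff_chi_phi11 (p := 3) (by norm_num) (by norm_num) hχ hprim W D (by norm_num) (by norm_num) hf hopt (by decide)⟩

/-- **C2 and the residual C5 shape at `1100 = 2²·5²·11` on the `χ₅`-image of `11a`**: `|c| = 1`, `2 ∤ c`, `5 ∤ c`.  No printed fact.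
[cite: CremonaAlgorithms1997, Table 1 (1100)] -/
theorem shapes_elevenHundred [Fact (Nat.Prime 5)] (χ : DirichletCharacter ℂ 5) (hχ : χ.IsQuadratic) (hprim : χ.IsPrimitive)
    (W : WeierstrassCurve ℚ) [W.IsElliptic] [W.IsGloballyMinimal] [NeZero (1100 : ℕ)] (D : ModularParametrizationData W 1100)
    (hf : ∀ n : ℕ, cuspCoeff D.f n = χ n * cuspCoeff cuspFormEtaProductEleven n)
    (hopt : ∀ z ∈ D.L.lattice, ∃ w ∈ periodLattice D.f, z = D.c * w) :
    |D.maninConstant| = 1 ∧ ¬ (2 : ℤ) ∣ D.maninConstant ∧ ¬ (5 : ℤ) ∣ D.maninConstant :=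
  ⟨abs_maninConstant_eq_one_of_cuspCoeff_chi_phi11 (p := 5) (by norm_num) (by norm_num) hχ hprim W D (by norm_num) (by norm_num) hf hopt,
   not_dvd_maninConstant_of_cuspCoeff_chi_phi11 (p := 5) (by norm_num) (by norm_num) hχ hprim W D (by norm_num) (by norm_num) hf hopt (by decide),
   not_dvd_maninConstant_of_cuspCoeff_chi_phi11 (p := 5) (by norm_num) (by norm_num) hχ hprim W D (by norm_num) (by norm_num) hf hopt (by decide)⟩

end Summit.BirchSwinnertonDyer.BirchSwinnertonDyer.Theorems.ManinLocalTwoThree.RootSqueezeEleven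

end
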